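import Summits.QuantumFields.YangMills.Theorems.BalabanUVNodesN15VectorPieceNE2Zero
import Summits.QuantumFields.YangMills.Theorems.BalabanUVNodesN15GenuineSiteKernelRate
import HarnessLib

/-!
# Route «BalabanUVNodes» (K4 «SpineRates»), node N15 = NE2 — THE `_rel` SITE DATUM INHABITED BY THE GENUINE `U ≡ 1` SITE FORM OF [B4-I]∕[B5] (`Q′G′²Q′*` ⊗ 1) ON THE TORUS
# FAMILY OF RECORD, AND `N15At` — ALL THREE CONJUNCTS BY NAME — FOR THE BACKGROUND-LIVE (3.60)-WORDS FAMILY WITH THE GENUINE SITE FORM AND THE PIECE's OWN UNIT FORM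

Cell `pub-ymgap`, seat `pub-ymgap-dag-n15-c` (generation g7; R134 ACCELERATION SEAT, strategy s1; HUMAN RULING D-0062; chair R424 venue; `bears_on: R4∕N15`).  Filed
`--supports stmt-QuantumFields-20296 --as helper` (K3⁵; count-neutral).  Imports BY NAME this seat's E4 `…N15VectorPieceNE2Zero` (→ E2 `n15At_vectorPiece_vWordsExpC_of_siteRel`,
R3s `SiteRelDatum`, M4 `tensorId`∕`hasMaj_tensorId`, E1 `tensorId_comp`, R4 `idef_id_id`) and G1 `…N15GenuineSiteKernelRate` (`gram_rate_family`, `kerRe_decay_family`); b05's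
`qggqRe_mul_kerRe`; nothing in the tree is modified.

WHY.  The site layer of the seat's faces of record (R2s∕R3s, E2) carries an ABSTRACT `U ≡ 1` site form `Ks` with three NE2⁰-type letters (`SiteRelDatum`: decaying inverse, `KsWs = 1`,
η-defect `≤ M₀θ_j e^{−δd}`); its inhabitants so far were R4's identity forms (trivial) and E3's MASSIVE forms `c·1 + Q(G⊗1)²Q*` (an artificial mass `c ≥ c₀`; the piece's own form
is singular, E1).  G1 made the letters of the GENUINE form — [B4-I]'s `Q′G′²Q′*` with the full positive propagator, inverse `(Q′G′²Q′*)⁻¹` = the kernel of [B9] Thm 3.2 at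
`U ≡ 1` — theorems on the torus family of record (unit tori `M_μ = 2L^{m_T}`, coarse scale `k ≥ 1`, King's couplings).  This file lifts them to the vector carrier (`⊗ 1` on the
direction and Lie-algebra indices) and closes the datum.

WHAT THIS FILE IS.
* §1 (ns `…N15.GenuineSite`) the SCALAR-TO-VECTOR LIFT of a unit-lattice matrix: `torSiteMat M S` (the matrix `S` on `Idx M` acting on unit-torus functions through b05's chart
  `torIdx`), `torSiteMat_apply ∕ _mul ∕ _one ∕ _sub`, `hasMaj_torSiteMat` (entry bounds ⇒ a sharp-block majorant, blocks = sites); `torSiteLift ι M S := (torSiteMat M S ⊗ 1_{Fin(d+1)}) ⊗ 1_ι`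
  on the unit-bond site lattice `(Tor M × Fin (d+1)) × ι` of the seat's faces, `torSiteLift_mul ∕ _one ∕ _sub`, `hasMaj_torSiteLift` (M4 `hasMaj_tensorId` twice), `idef_id_id_eq`.
* §2 (ns `…N15.VectorPiece`) `IsRecordIndex L j` (`k ≥ 1` and `M_μ = 2L^{m_T}` for some `m_T`: the sub-family of the seat's index type `VecIndexS d L` on which dag-n15-a's two-grid
  rates are theorems), the GENUINE SITE DATA `genuineKsV ∕ genuineKsV′ ∕ genuineWsV ∕ genuineWsV′ ι L b j` (= `Q′G′²Q′* ⊗ 1`, its fine twin at King's coupling `a_{k+m}`, and their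
  inverses `(Q′G′²Q′*)⁻¹ ⊗ 1` at every index of record; the identity form at the other indices — R4's trivial datum, said), ★★ **`siteRelDatum_genuine`**: for odd `L ≥ 3`,
  `b > 0`: `∃ βW δW M₀, SiteRelDatum (genuineWsV …) (genuineWsV′ …) (genuineKsV …) (genuineKsV′ …) βW δW M₀` — every letter a theorem (G1 + `qggqRe_mul_kerRe`).
* §3 ★★★ **`n15At_vectorPiece_vWordsExpC_genuineSite`**: `N15At` with `Kop := vWGCVecFamily4` (F16), `Ksite := vWGCVecSiteRelKernel … genuineWsV genuineWsV′ genuineKsV genuineKsV′`,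
  `Kunit :=` E2's own-form unit kernel — ALL THREE CONJUNCTS BY NAME for the background-live (3.60)-words family, NO `U ≡ 1` datum displayed, NO artificial mass: the site form is
  the genuine one at every index of record (`d + 1 ≥ 2`, odd `L ≥ 3`, `c₃₅ > 0`, weight `0 < |a| ≤ ownWeightBound`, coupling `b > 0`); `ne2ZeroSite_vectorPiece_vWordsExpC_genuineSite`
  (E4's corollary at the genuine datum); closer `s_N15_of_vWordsExpCGenuineSiteReading`.

HONEST FRAMING ∕ LIMITS.  The dressed site kernel of the face is S1's `[Ks + P(A′)]⁻¹` with `Ks = Q′G′²Q′* ⊗ 1` the genuine `U ≡ 1` form of [B5]'s SCALAR theory (diagonal-gauge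
reading for the vector theory) and `P(A′)` the dressing words of the -a LINEAR vector piece — a MODEL-LEVEL object (the two factors come from different `U ≡ 1` propagators: [B5]'s
full `G′ = (Δ′ + aQ′*Q′)⁻¹` in `Ks`, the (2.156) single-scale piece in `P`); outside the torus family of record (`k = 0` or periods not of the form `2L^{m_T}`) the datum is the
identity (no rate is claimed there).  King's running couplings; constants crude and ours.  NE2⁺ NOT PRINTED, NOT proved for Bałaban's `G(U)`; count-neutral (typed 28∕28 · discharged
5∕27 of record unchanged); N15 NOT discharged; one finite T⁴ at fixed ε — NOT ℝ⁴, NOT infinite volume, NOT OS, NOT a mass gap, NOT Clay.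
-/

noncomputable section

open scoped BigOperators Matrix
open Finset

/-! ## §1 The scalar-to-vector lift of a unit-lattice matrix -/

namespace Summit.QuantumFields.YangMills.BalabanUVNodes.N15.GenuineSite

open Literature.MathematicalPhysics.QuantumFieldTheory.Balaban1983to89
open Literature.MathematicalPhysics.QuantumFieldTheory.Balaban1983to89.B11SectG (BlockNorm HasMaj)
open Literature.MathematicalPhysics.QuantumFieldTheory.Balaban1983to89.B11AxialTransport190 (abs_le_loc_ofBlocks loc_ofBlocks_le)
open Literature.MathematicalPhysics.QuantumFieldTheory.Balaban1983to89.T4EtaRateDefect (idef)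
open Literature.MathematicalPhysics.QuantumFieldTheory.Balaban1983to89.B5Prop11Plancherel (Tor)
open Literature.MathematicalPhysics.QuantumFieldTheory.Balaban1983to89.B5QGGQ145Bounds (Idx)
open Literature.MathematicalPhysics.QuantumFieldTheory.Balaban1983to89.B5PBridgeProjection (torIdx)
open Summit.QuantumFields.YangMills.BalabanUVNodes.N15.MatrixSpecies (liftBlk)
open Summit.QuantumFields.YangMills.BalabanUVNodes.N15.VectorPiece (tensorId tensorId_apply hasMaj_tensorId)

variable {d : ℕ} (M : Fin (d + 1) → ℕ) [∀ μ, NeZero (M μ)]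

section Lift

/-- A MATRIX ON THE UNIT LATTICE `Idx M` ACTING ON UNIT-TORUS FUNCTIONS (through b05's chart `torIdx : Tor M ≃ Idx M`): `(S·f)(y) = Σ_{y′} S(y, y′) f(y′)`. [folklore] -/
def torSiteMat (S : Matrix (Idx M) (Idx M) ℝ) : (Tor M → ℝ) →ₗ[ℝ] (Tor M → ℝ) :=
  Matrix.toLin' (S.submatrix (torIdx M) (torIdx M))

/-- Unfolding: `(S·f)(y) = Σ_{y′} S(torIdx y, torIdx y′)·f(y′)`. [folklore] -/
theorem torSiteMat_apply (S : Matrix (Idx M) (Idx M) ℝ) (f : Tor M → ℝ) (y : Tor M) :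
    torSiteMat M S f y = ∑ y' : Tor M, S (torIdx M y) (torIdx M y') * f y' := by
  rw [torSiteMat, Matrix.toLin'_apply]
  rfl

/-- Functoriality: `(S·T)· = S·(T·)`. [folklore] -/
theorem torSiteMat_mul (S T : Matrix (Idx M) (Idx M) ℝ) : torSiteMat M (S * T) = torSiteMat M S ∘ₗ torSiteMat M T := by
  rw [torSiteMat, torSiteMat, torSiteMat, ← Matrix.toLin'_mul, Matrix.submatrix_mul_equiv]

/-- The unit matrix acts as the identity. [folklore] -/
theorem torSiteMat_one : torSiteMat M 1 = LinearMap.id := by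
  rw [torSiteMat, Matrix.submatrix_one_equiv, Matrix.toLin'_one]

/-- Additivity: `(S − T)· = S· − T·`. [folklore] -/
theorem torSiteMat_sub (S T : Matrix (Idx M) (Idx M) ℝ) : torSiteMat M (S - T) = torSiteMat M S - torSiteMat M T := by
  rw [torSiteMat, torSiteMat, torSiteMat, ← map_sub]
  rfl

/-- **ENTRY BOUNDS ⇒ A SHARP-BLOCK MAJORANT, BLOCKS = SITES**: if `|S(y,y′)| ≤ K(b(y), b(y′))` for an injective block labelling `b` of the unit torus and `K ≥ 0`, then `S·` has the
block majorant `K` between the sharp block norms (a function localised at the block `b(y′)` is a multiple of `δ_{y′}`). [cite: Balaban1984PropagatorsII, (2.51)–(2.52) p.232 (shape)] -/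
theorem hasMaj_torSiteMat {g : B6.Geometry} (blk : Tor M → g.Site) (hblk : Function.Injective blk) {S : Matrix (Idx M) (Idx M) ℝ} {K : g.Site → g.Site → ℝ}
    (hK0 : ∀ y y', 0 ≤ K y y') (hK : ∀ y y' : Tor M, |S (torIdx M y) (torIdx M y')| ≤ K (blk y) (blk y')) :
    HasMaj (BlockNorm.ofBlocks g blk) (BlockNorm.ofBlocks g blk) (torSiteMat M S) K := by
  classical
  intro y₀' f hf y₀
  have hL0 := (BlockNorm.ofBlocks g blk).loc_nonneg y₀' f
  refine loc_ofBlocks_le blk _ (mul_nonneg (hK0 _ _) hL0) fun x hx => ?_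
  rw [torSiteMat_apply]
  by_cases hne : ∃ x₁ : Tor M, blk x₁ = y₀'
  · obtain ⟨x₁, hx₁⟩ := hne
    have hzero : ∀ y' : Tor M, y' ≠ x₁ → S (torIdx M x) (torIdx M y') * f y' = 0 := fun y' hy' => by
      rw [hf y' (fun h => hy' (hblk (h.trans hx₁.symm))), mul_zero]
    rw [Finset.sum_eq_single x₁ (fun y' _ hy' => hzero y' hy') (fun h => (h (mem_univ _)).elim), abs_mul, ← hx, ← hx₁]
    exact mul_le_mul (hK x x₁) (abs_le_loc_ofBlocks blk f rfl) (abs_nonneg _) (hK0 _ _)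
  · have hzero : ∀ y' : Tor M, S (torIdx M x) (torIdx M y') * f y' = 0 := fun y' => by
      rw [hf y' (fun h => hne ⟨y', h⟩), mul_zero]
    rw [Finset.sum_eq_zero (fun y' _ => hzero y'), abs_zero]
    exact mul_nonneg (hK0 _ _) hL0

variable (ι : Type)

/-- THE SCALAR-TO-VECTOR LIFT `(S ⊗ 1_{Fin(d+1)}) ⊗ 1_ι` on the unit-bond site lattice `(Tor M × Fin (d+1)) × ι` of the seat's faces: the scalar unit-lattice matrix acting diagonally in the
bond direction and the Lie-algebra coordinate. [cite: Balaban1984PropagatorsII, (2.156) p.250 (the `U ≡ 1` operators act diagonally in 𝔤: shape)] -/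
def torSiteLift (S : Matrix (Idx M) (Idx M) ℝ) : ((Tor M × Fin (d + 1)) × ι → ℝ) →ₗ[ℝ] ((Tor M × Fin (d + 1)) × ι → ℝ) :=
  tensorId ι (tensorId (Fin (d + 1)) (torSiteMat M S))

/-- Functoriality of the lift. [folklore] -/
theorem torSiteLift_mul (S T : Matrix (Idx M) (Idx M) ℝ) : torSiteLift M ι (S * T) = torSiteLift M ι S ∘ₗ torSiteLift M ι T := by
  rw [torSiteLift, torSiteLift, torSiteLift, torSiteMat_mul]
  rfl

/-- The lift of the unit matrix is the identity. [folklore] -/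
theorem torSiteLift_one : torSiteLift M ι 1 = LinearMap.id := by
  rw [torSiteLift, torSiteMat_one]
  rfl

/-- Additivity of the lift. [folklore] -/
theorem torSiteLift_sub (S T : Matrix (Idx M) (Idx M) ℝ) : torSiteLift M ι (S - T) = torSiteLift M ι S - torSiteLift M ι T := by
  rw [torSiteLift, torSiteLift, torSiteLift, torSiteMat_sub]
  rfl

/-- **THE LIFT KEEPS ENTRY MAJORANTS**: `|S(y,y′)| ≤ K(y,y′)`, `K ≥ 0` ⇒ the lift has the block majorant `K` between the sharp block norms of the unit-bond site lattice blocked by the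
base point (`hasMaj_torSiteMat` + M4 `hasMaj_tensorId` twice; the lift is functorial by `rfl`, E1 `tensorId_comp`). [folklore] -/
theorem hasMaj_torSiteLift [Fintype ι] {g : B6.Geometry} (blk : Tor M → g.Site) (hblk : Function.Injective blk) {S : Matrix (Idx M) (Idx M) ℝ} {K : g.Site → g.Site → ℝ}
    (hK0 : ∀ y y', 0 ≤ K y y') (hK : ∀ y y' : Tor M, |S (torIdx M y) (torIdx M y')| ≤ K (blk y) (blk y')) :
    HasMaj (BlockNorm.ofBlocks g (liftBlk (liftBlk blk (Fin (d + 1))) ι)) (BlockNorm.ofBlocks g (liftBlk (liftBlk blk (Fin (d + 1))) ι)) (torSiteLift M ι S) K :=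
  hasMaj_tensorId ι hK0 (hasMaj_tensorId (Fin (d + 1)) hK0 (hasMaj_torSiteMat M blk hblk hK0 hK))

/-- `𝔇(T′, T)` through identity transports is `T′ − T`. [folklore] -/
theorem idef_id_id_eq {F : Type} [AddCommGroup F] [Module ℝ F] (T' T : F →ₗ[ℝ] F) : idef LinearMap.id LinearMap.id T' T = T' - T := rfl

end Lift

end Summit.QuantumFields.YangMills.BalabanUVNodes.N15.GenuineSite

/-! ## §2 The genuine site data on the seat's index family and ★★ `siteRelDatum_genuine` -/

namespace Summit.QuantumFields.YangMills.BalabanUVNodes.N15.VectorPiece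

open Literature.MathematicalPhysics.QuantumFieldTheory.Balaban1983to89
open Literature.MathematicalPhysics.QuantumFieldTheory.Balaban1983to89.B11SectG (BlockNorm HasMaj hasMaj_zero)
open Literature.MathematicalPhysics.QuantumFieldTheory.Balaban1983to89.T4EtaRate (PairedInstance NE2PlusSite)
open Literature.MathematicalPhysics.QuantumFieldTheory.Balaban1983to89.T4EtaRateSiteOfRatePair (NE2ZeroSite)
open Literature.MathematicalPhysics.QuantumFieldTheory.Balaban1983to89.T4EtaRateDefect (idef)
open Literature.MathematicalPhysics.QuantumFieldTheory.Balaban1983to89.B5Prop11Plancherel (Tor fine)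
open Literature.MathematicalPhysics.QuantumFieldTheory.Balaban1983to89.B4Sect5Torus (tdist tdist_nonneg)
open Literature.MathematicalPhysics.QuantumFieldTheory.Balaban1983to89.B5QGGQ145Bounds (Idx kerRe qggqRe qggqRe_mul_kerRe)
open Literature.MathematicalPhysics.QuantumFieldTheory.Balaban1983to89.B5PBridgeProjection (torIdx)
open Literature.MathematicalPhysics.QuantumFieldTheory.Balaban1983to89.B9Eq3130MatrixLetters (hasMaj_id_ofBlocks)
open Literature.MathematicalPhysics.QuantumFieldTheory.King1986 (aK aK_pos)
open Literature.MathematicalPhysics.QuantumFieldTheory.King1986.Torus (tdistT tdistT_nonneg tdistT_self)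
open Summit.QuantumFields.YangMills.BalabanUVNodes.N15.MatrixSpecies (liftMap liftBlk)
open Summit.QuantumFields.YangMills.BalabanUVNodes.N15.SiteLayer (unitForm₀)
open Summit.QuantumFields.YangMills.BalabanUVNodes.N15.GenuineSite (torSiteLift torSiteLift_mul torSiteLift_one torSiteLift_sub hasMaj_torSiteLift idef_id_id_eq gram_rate_family
  kerRe_decay_family)
open Summit.QuantumFields.YangMills.BalabanUVNodes.N15.TwoGrid (tdistT_eq_tdist_torIdx)
open YMDAG.UVSplit (N15At RateCarriers RateRecordPred S_N15 Datum)
open Literature.MathematicalPhysics.QuantumFieldTheory.Balaban1983to89.T4Continuum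

variable {d : ℕ}

section Datum

variable (ι : Type) [Fintype ι] (L : ℕ) [NeZero L] (b : ℝ)

/-- AN INDEX OF THE TORUS FAMILY OF RECORD inside the seat's sized index family: coarse scale `k ≥ 1` and a unit torus with all periods `M_μ = 2L^{m_T}` — the sub-family on which
dag-n15-a's two-grid rates (King's Prop. 3.8 on the cubes `2L^e` of [King1986] p.664) are theorems. [bookkeeping] -/
def IsRecordIndex (j : VecIndexS d L) : Prop := 1 ≤ j.k ∧ ∃ mT : ℕ, ∀ μ, j.Mn μ = 2 * L ^ mT

open Classical in
/-- THE GENUINE COARSE `U ≡ 1` SITE FORM `Q′G′²Q′* ⊗ 1` (b05's `qggqRe` at the grid `L^k` and King's coupling `a_k = aK b L k`) at every index of record; the identity form at the other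
indices. [cite: Balaban1984PropagatorsI, p.25 (the form `Q′G′²Q′*`); King1986, (2.13) p.653 (the couplings)] -/
def genuineKsV (j : VecIndexS d L) : ((Tor j.Mn × Fin (d + 1)) × ι → ℝ) →ₗ[ℝ] ((Tor j.Mn × Fin (d + 1)) × ι → ℝ) :=
  if IsRecordIndex L j then torSiteLift j.Mn ι (qggqRe (L ^ j.k) (aK b L j.k) j.Mn) else LinearMap.id

open Classical in
/-- THE GENUINE FINE `U ≡ 1` SITE FORM (grid `L^m·L^k`, coupling `a_{k+m}`) at every index of record; the identity form elsewhere. [cite: Balaban1984PropagatorsI, p.25; King1986, (2.13) p.653] -/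
def genuineKsV' (j : VecIndexS d L) : ((Tor j.Mn × Fin (d + 1)) × ι → ℝ) →ₗ[ℝ] ((Tor j.Mn × Fin (d + 1)) × ι → ℝ) :=
  if IsRecordIndex L j then torSiteLift j.Mn ι (qggqRe (L ^ j.m * L ^ j.k) (aK b L (j.k + j.m)) j.Mn) else LinearMap.id

open Classical in
/-- THE GENUINE COARSE `U ≡ 1` SITE KERNEL `(Q′G′²Q′*)⁻¹ ⊗ 1` (b05's `kerRe`, the kernel of [B9] Thm 3.2 at `U ≡ 1`) at every index of record; the identity elsewhere.
[cite: Balaban1984PropagatorsI, (1.45) p.26; Balaban1985BackgroundPropagators, Thm 3.2 (3.48) p.398 (the kernel)] -/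
def genuineWsV (j : VecIndexS d L) : ((Tor j.Mn × Fin (d + 1)) × ι → ℝ) →ₗ[ℝ] ((Tor j.Mn × Fin (d + 1)) × ι → ℝ) :=
  if IsRecordIndex L j then torSiteLift j.Mn ι (kerRe (L ^ j.k) (aK b L j.k) j.Mn) else LinearMap.id

open Classical in
/-- THE GENUINE FINE `U ≡ 1` SITE KERNEL at every index of record; the identity elsewhere. [cite: Balaban1984PropagatorsI, (1.45) p.26; Balaban1985BackgroundPropagators, Thm 3.2 (3.48) p.398] -/
def genuineWsV' (j : VecIndexS d L) : ((Tor j.Mn × Fin (d + 1)) × ι → ℝ) →ₗ[ℝ] ((Tor j.Mn × Fin (d + 1)) × ι → ℝ) :=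
  if IsRecordIndex L j then torSiteLift j.Mn ι (kerRe (L ^ j.m * L ^ j.k) (aK b L (j.k + j.m)) j.Mn) else LinearMap.id

variable {ι L b}

/-- ★★ **THE `_rel` SITE DATUM IS INHABITED BY THE GENUINE `U ≡ 1` SITE FORM.**  For odd `L ≥ 3` and `b > 0` there are `β_W ≥ 0`, `δ_W > 0`, `M₀ ≥ 0` with
`SiteRelDatum (genuineWsV ι L b) (genuineWsV′ ι L b) (genuineKsV ι L b) (genuineKsV′ ι L b) β_W δ_W M₀` — at every index of record the three NE2⁰-type letters of the GENUINE form are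
G1's theorems lifted by `⊗ 1` (`kerRe_decay_family` for the inverses' majorant, b05's `qggqRe_mul_kerRe` for `KsWs = 1`, `gram_rate_family` at `γ = ½` for the η-defect
`≤ M₀·(L^k)^{−¼}·e^{−δ_W d}`); at the other indices R4's identity datum. [cite: Balaban1984PropagatorsI, (1.45) p.26, p.25; Balaban1985BackgroundPropagators, Thm 3.2 (3.48) p.398;
King1986, Prop. 3.8 (3.71) p.664, Lemma 4.5 (4.38) p.674 (rate shape)] -/
theorem siteRelDatum_genuine (hLodd : Odd L) (hL2 : 2 ≤ L) (hb : 0 < b) :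
    ∃ βW δW M₀ : ℝ, SiteRelDatum (d := d) (ι := ι) (L := L) (genuineWsV ι L b) (genuineWsV' ι L b) (genuineKsV ι L b) (genuineKsV' ι L b) βW δW M₀ := by
  classical
  obtain ⟨δ₁, C₁, hδ₁, hC₁, HG⟩ := gram_rate_family (d := d) hLodd hL2 hb (γ := 1 / 2) (by norm_num) (by norm_num)
  obtain ⟨δ₂, C₂, hδ₂, hC₂, HI⟩ := kerRe_decay_family (d := d) hL2 hb
  have hL0 : 0 < L := by omega
  set δW : ℝ := min δ₁ δ₂ with hδW
  have hδWpos : 0 < δW := lt_min hδ₁ hδ₂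
  have hδW1 : δW ≤ δ₁ := min_le_left _ _
  have hδW2 : δW ≤ δ₂ := min_le_right _ _
  set βW : ℝ := max C₂ 1 with hβW
  have hβW0 : 0 ≤ βW := zero_le_one.trans (le_max_right _ _)
  have hθ0 : ∀ j : VecIndexS d L, 0 ≤ thetaV L j := fun j => by unfold thetaV; positivity
  -- the three kernels of the datum, as functions on the unit torus of an index
  have hdist : ∀ (j : VecIndexS d L) (y y' : Tor j.Mn), (unitTorusGeoS L j.k j.Mn j.Msz).dist y y' = tdist j.Mn (torIdx j.Mn y) (torIdx j.Mn y') :=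
    fun j y y' => tdistT_eq_tdist_torIdx j.Mn y y'
  have hinj : ∀ j : VecIndexS d L, Function.Injective (fun y : Tor j.Mn => (y : (unitTorusGeoS L j.k j.Mn j.Msz).Site)) := fun j y y' h => h
  -- the identity datum's letters (R4)
  have hId : ∀ j : VecIndexS d L, HasMaj (BlockNorm.ofBlocks (unitTorusGeoS L j.k j.Mn j.Msz) (liftBlk (fun p : Tor j.Mn × Fin (d + 1) => p.1) ι))
      (BlockNorm.ofBlocks (unitTorusGeoS L j.k j.Mn j.Msz) (liftBlk (fun p : Tor j.Mn × Fin (d + 1) => p.1) ι)) LinearMap.id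
      (fun y y' => βW * Real.exp (-(δW * (unitTorusGeoS L j.k j.Mn j.Msz).dist y y'))) := fun j =>
    (hasMaj_id_ofBlocks (g := unitTorusGeoS L j.k j.Mn j.Msz) (liftBlk (fun p : Tor j.Mn × Fin (d + 1) => p.1) ι) (fun y => tdistT_self j.Mn y) δW).mono
      fun y y' => mul_le_mul_of_nonneg_right (le_max_right _ _) (Real.exp_nonneg _)
  -- the genuine inverses' majorant (G1 `kerRe_decay_family`), lifted
  have hW : ∀ (j : VecIndexS d L), 1 ≤ j.k → ∀ (n : ℕ) [NeZero n] (c : ℕ), 1 ≤ c → (c = j.k ∨ c = j.k + j.m) →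
      HasMaj (BlockNorm.ofBlocks (unitTorusGeoS L j.k j.Mn j.Msz) (liftBlk (fun p : Tor j.Mn × Fin (d + 1) => p.1) ι))
        (BlockNorm.ofBlocks (unitTorusGeoS L j.k j.Mn j.Msz) (liftBlk (fun p : Tor j.Mn × Fin (d + 1) => p.1) ι)) (torSiteLift j.Mn ι (kerRe n (aK b L c) j.Mn))
        (fun y y' => βW * Real.exp (-(δW * (unitTorusGeoS L j.k j.Mn j.Msz).dist y y'))) := by
    intro j _ n _ c hc _
    refine hasMaj_torSiteLift j.Mn ι (g := unitTorusGeoS L j.k j.Mn j.Msz) (fun y : Tor j.Mn => y) (hinj j)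
      (fun y y' => mul_nonneg hβW0 (Real.exp_nonneg _)) fun y y' => ?_
    refine (HI c hc n j.Mn (torIdx j.Mn y) (torIdx j.Mn y')).trans ?_
    rw [hdist]
    exact mul_le_mul (le_max_left _ _) (Real.exp_le_exp.mpr (by nlinarith [tdist_nonneg j.Mn (torIdx j.Mn y) (torIdx j.Mn y')])) (Real.exp_nonneg _) hβW0
  refine ⟨βW, δW, C₁, hβW0, hδWpos, hC₁.le, fun j => ?_, fun j => ?_, fun j => ?_, fun j => ?_, fun j => ?_⟩
  · -- the coarse inverse
    by_cases hj : IsRecordIndex L j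
    · rw [genuineWsV, if_pos hj]; exact hW j hj.1 (L ^ j.k) j.k hj.1 (Or.inl rfl)
    · rw [genuineWsV, if_neg hj]; exact hId j
  · -- the fine inverse
    by_cases hj : IsRecordIndex L j
    · haveI : NeZero (L ^ j.m * L ^ j.k) := ⟨Nat.mul_ne_zero (pow_ne_zero _ (NeZero.ne L)) (pow_ne_zero _ (NeZero.ne L))⟩
      have hk : 1 ≤ j.k := hj.1
      rw [genuineWsV', if_pos hj]; exact hW j hk (L ^ j.m * L ^ j.k) (j.k + j.m) (by omega) (Or.inr rfl)
    · rw [genuineWsV', if_neg hj]; exact hId j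
  · -- `KsWs = 1`, coarse
    by_cases hj : IsRecordIndex L j
    · have hM1 : ∀ i, 1 ≤ j.Mn i := fun i => Nat.one_le_iff_ne_zero.mpr (NeZero.ne (j.Mn i))
      have hLr : (1 : ℝ) < L := by exact_mod_cast (show 1 < L by omega)
      rw [genuineKsV, genuineWsV, if_pos hj, if_pos hj, ← torSiteLift_mul, qggqRe_mul_kerRe (L ^ j.k) (Nat.one_le_pow _ _ hL0) (aK b L j.k) (aK_pos hb hLr hj.1) hM1,
        torSiteLift_one]
    · rw [genuineKsV, genuineWsV, if_neg hj, if_neg hj]; rfl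
  · -- `Ks′Ws′ = 1`, fine
    by_cases hj : IsRecordIndex L j
    · have hM1 : ∀ i, 1 ≤ j.Mn i := fun i => Nat.one_le_iff_ne_zero.mpr (NeZero.ne (j.Mn i))
      have hLr : (1 : ℝ) < L := by exact_mod_cast (show 1 < L by omega)
      haveI : NeZero (L ^ j.m * L ^ j.k) := ⟨Nat.mul_ne_zero (pow_ne_zero _ (NeZero.ne L)) (pow_ne_zero _ (NeZero.ne L))⟩
      have hk : 1 ≤ j.k := hj.1
      rw [genuineKsV', genuineWsV', if_pos hj, if_pos hj, ← torSiteLift_mul,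
        qggqRe_mul_kerRe (L ^ j.m * L ^ j.k) (Nat.mul_ne_zero (pow_ne_zero _ (NeZero.ne L)) (pow_ne_zero _ (NeZero.ne L)) |> Nat.one_le_iff_ne_zero.mpr)
          (aK b L (j.k + j.m)) (aK_pos hb hLr (by omega)) hM1, torSiteLift_one]
    · rw [genuineKsV', genuineWsV', if_neg hj, if_neg hj]; rfl
  · -- the η-defect of the genuine form (G1 `gram_rate_family`), lifted
    by_cases hj : IsRecordIndex L j
    · obtain ⟨hk, mT, hM⟩ := hj
      have hj' : IsRecordIndex L j := ⟨hk, mT, hM⟩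
      haveI : NeZero (L ^ j.m * L ^ j.k) := ⟨Nat.mul_ne_zero (pow_ne_zero _ (NeZero.ne L)) (pow_ne_zero _ (NeZero.ne L))⟩
      rw [genuineKsV, genuineKsV', if_pos hj', if_pos hj', idef_id_id_eq, ← torSiteLift_sub]
      refine hasMaj_torSiteLift j.Mn ι (g := unitTorusGeoS L j.k j.Mn j.Msz) (fun y : Tor j.Mn => y) (hinj j)
        (fun y y' => mul_nonneg (mul_nonneg hC₁.le (hθ0 j)) (Real.exp_nonneg _)) fun y y' => ?_
      have h := HG mT j.k j.m hk j.Mn hM (torIdx j.Mn y) (torIdx j.Mn y')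
      have hcast : ((L ^ j.k : ℕ) : ℝ) = (L : ℝ) ^ j.k := by push_cast; ring
      have hq : (-((1 : ℝ) / 2 / 2)) = -(1 / 4) := by norm_num
      rw [hcast, hq] at h
      rw [hdist]
      refine h.trans ?_
      show C₁ * ((L : ℝ) ^ j.k) ^ (-(1 / 4 : ℝ)) * Real.exp (-(δ₁ * tdist j.Mn (torIdx j.Mn y) (torIdx j.Mn y')))
        ≤ C₁ * thetaV L j * Real.exp (-(δW * tdist j.Mn (torIdx j.Mn y) (torIdx j.Mn y')))
      exact mul_le_mul_of_nonneg_left (Real.exp_le_exp.mpr (by nlinarith [tdist_nonneg j.Mn (torIdx j.Mn y) (torIdx j.Mn y')])) (mul_nonneg hC₁.le (hθ0 j))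
    · rw [genuineKsV, genuineKsV', if_neg hj, if_neg hj, idef_id_id_eq, sub_self]
      exact (hasMaj_zero _ _).mono fun y y' => mul_nonneg (mul_nonneg hC₁.le (hθ0 j)) (Real.exp_nonneg _)

omit [NeZero L] in
/-- The index family of record is inhabited inside `VecIndexS d L` for `L ≥ 1` (periods `2L`, `k = m = 1`), so the genuine branch of the datum is live. [folklore] -/
theorem exists_isRecordIndex (hL : 1 ≤ L) : ∃ j : VecIndexS d L, IsRecordIndex L j := by
  refine ⟨⟨⟨fun _ => ⟨2 * L, by omega⟩, fun _ => Dvd.intro_left 2 rfl, 1, 1, le_rfl, 0⟩, 1, le_rfl⟩, le_rfl, 1, fun μ => ?_⟩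
  show 2 * L = 2 * L ^ 1
  rw [pow_one]

end Datum

/-! ## §3 ★★★ `N15At` — all three conjuncts by name — with the genuine site form and the own unit form -/

section Face

variable (𝔄 : Type) [NormedRing 𝔄] [NormedAlgebra ℝ 𝔄] [CompleteSpace 𝔄] (ι : Type) [Fintype ι] [DecidableEq ι] (e : 𝔄 ≃L[ℝ] (ι → ℝ)) (L : ℕ) [NeZero L]

/-- ★★★ **`N15At` — ALL THREE CONJUNCTS BY NAME, THE SITE FORM GENUINE, NO `U ≡ 1` DATUM DISPLAYED, NO ARTIFICIAL MASS** (parallel-transport species; `d + 1 ≥ 2`, odd `L ≥ 3`,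
`c₃₅ > 0`, any `p`, weight `0 < |a| ≤ ownWeightBound`, coupling `b > 0`): operator = F16's `ne2PlusOperator_vectorPiece_vWordsExpC`; site = R3s's relative layer at the GENUINE datum
`siteRelDatum_genuine` (`Q′G′²Q′* ⊗ 1` and `(Q′G′²Q′*)⁻¹ ⊗ 1` at every index of record); unit = E2's own-form layer. [bookkeeping] -/
theorem n15At_vectorPiece_vWordsExpC_genuineSite (hd : 1 ≤ d) (hLodd : Odd L) (hL2 : 2 ≤ L) {c35 : ℝ} (hc35 : 0 < c35) (p : ℝ) {a : ℝ} (ha : a ≠ 0)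
    (haa : |a| ≤ ownWeightBound (d := d) ι L (by omega) (by omega)) {b : ℝ} (hb : 0 < b) :
    N15At { I := VecIndexS d L, c35 := c35, p := p, pi := v1GVecInstance (d := d) 𝔄 ι L (by omega),
            Kop := vWGCVecFamily4 (d := d) 𝔄 ι e L a (by omega) (expFc ι e L) (expFsc ι e L) (expFf ι e L) (expFsf ι e L),
            Ksite := vWGCVecSiteRelKernel (d := d) 𝔄 ι e L a (by omega) (expFc ι e L) (expFsc ι e L) (expFf ι e L) (expFsf ι e L)
              (genuineWsV ι L b) (genuineWsV' ι L b) (genuineKsV ι L b) (genuineKsV' ι L b),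
            Kunit := vWGCVecUnitRelKernel (d := d) 𝔄 ι e L a (by omega) (expFc ι e L) (expFsc ι e L) (expFf ι e L) (expFsf ι e L)
              (ownUnitInvV ι L a) (ownUnitInvV' ι L a)
              (fun j => unitForm₀ a (liftMap (qbond L j.k j.Mn) ι) (tensorId ι (pieceG L j.Mn (L ^ j.k) j.k (rweight (d := d) L j.k))))
              (fun j => unitForm₀ a (liftMap (qbond L j.k j.Mn) ι ∘ liftMap (kingPrV L j.k j.m j.Mn) ι)
                (tensorId ι (pieceG L j.Mn (L ^ j.m * L ^ j.k) (j.k + j.m) (rweight (d := d) L j.k / ((L : ℝ) ^ j.m) ^ (d + 1))))),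
            inΛ := fun _ _ => True, unitDist := fun j => (unitTorusGeoS L j.k j.Mn j.Msz).dist } := by
  obtain ⟨βW, δW, M₀, hS⟩ := siteRelDatum_genuine (d := d) (ι := ι) (L := L) (b := b) hLodd hL2 hb
  exact n15At_vectorPiece_vWordsExpC_of_siteRel (d := d) 𝔄 ι e L (by omega) (by omega) hL2 hc35 p ha haa hS

/-- **NE2⁰-SITE for the relative site family AT THE GENUINE DATUM** (parallel-transport species), E4's corollary: `NE2ZeroSite 4 p` for the dressed kernel `[Q′G′²Q′* ⊗ 1 + P(A′)]⁻¹`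
at `A′ = 0`. [cite: Balaban1985BackgroundPropagators, Thm 3.2 (3.48) p.398 (the kernel, shape)] -/
theorem ne2ZeroSite_vectorPiece_vWordsExpC_genuineSite (hd : 1 ≤ d) (hLodd : Odd L) (hL2 : 2 ≤ L) (p a : ℝ) {b : ℝ} (hb : 0 < b) :
    NE2ZeroSite 4 p (v1GVecInstance (d := d) 𝔄 ι L (by omega))
      (vWGCVecSiteRelKernel (d := d) 𝔄 ι e L a (by omega) (expFc ι e L) (expFsc ι e L) (expFf ι e L) (expFsf ι e L)
        (genuineWsV ι L b) (genuineWsV' ι L b) (genuineKsV ι L b) (genuineKsV' ι L b)) := by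
  obtain ⟨βW, δW, M₀, hS⟩ := siteRelDatum_genuine (d := d) (ι := ι) (L := L) (b := b) hLodd hL2 hb
  exact ne2ZeroSite_vectorPiece_vWordsExpC_rel (d := d) 𝔄 ι e L a hd (by omega) p hS

variable {N : ℕ} [NeZero N] in
/-- **`S_N15` FOR EVERY PARALLEL-TRANSPORT-SPECIES READING AT THE GENUINE SITE DATUM** (weight in the certified window, coupling `b > 0`): the K4 stub closed over every
rate-carrier predicate whose NE2 component is the record above — no layer of `N15At` a hypothesis, no `U ≡ 1` datum displayed. [bookkeeping] -/
theorem s_N15_of_vWordsExpCGenuineSiteReading (hd : 1 ≤ d) (hLodd : Odd L) (hL2 : 2 ≤ L) (RRec : RateRecordPred N)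
    (hread : ∀ (F : T4Family) (D : Datum F N) (g₀ : ℕ → ℝ) (os : List (ULoop F)) (R : RateCarriers N), RRec F D g₀ os R →
      ∃ (a c35 p b : ℝ), a ≠ 0 ∧ |a| ≤ ownWeightBound (d := d) ι L (by omega) (by omega) ∧ 0 < c35 ∧ 0 < b ∧
        R.ne2 = { I := VecIndexS d L, c35 := c35, p := p, pi := v1GVecInstance (d := d) 𝔄 ι L (by omega),
                  Kop := vWGCVecFamily4 (d := d) 𝔄 ι e L a (by omega) (expFc ι e L) (expFsc ι e L) (expFf ι e L) (expFsf ι e L),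
                  Ksite := vWGCVecSiteRelKernel (d := d) 𝔄 ι e L a (by omega) (expFc ι e L) (expFsc ι e L) (expFf ι e L) (expFsf ι e L)
                    (genuineWsV ι L b) (genuineWsV' ι L b) (genuineKsV ι L b) (genuineKsV' ι L b),
                  Kunit := vWGCVecUnitRelKernel (d := d) 𝔄 ι e L a (by omega) (expFc ι e L) (expFsc ι e L) (expFf ι e L) (expFsf ι e L)
                    (ownUnitInvV ι L a) (ownUnitInvV' ι L a)
                    (fun j => unitForm₀ a (liftMap (qbond L j.k j.Mn) ι) (tensorId ι (pieceG L j.Mn (L ^ j.k) j.k (rweight (d := d) L j.k))))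
                    (fun j => unitForm₀ a (liftMap (qbond L j.k j.Mn) ι ∘ liftMap (kingPrV L j.k j.m j.Mn) ι)
                      (tensorId ι (pieceG L j.Mn (L ^ j.m * L ^ j.k) (j.k + j.m) (rweight (d := d) L j.k / ((L : ℝ) ^ j.m) ^ (d + 1))))),
                  inΛ := fun _ _ => True, unitDist := fun j => (unitTorusGeoS L j.k j.Mn j.Msz).dist }) :
    S_N15 RRec := by
  intro F D g₀ os R hR
  obtain ⟨a, c35, p, b, ha, haa, hc35, hb, hne2⟩ := hread F D g₀ os R hR
  rw [hne2]
  exact n15At_vectorPiece_vWordsExpC_genuineSite 𝔄 ι e L hd hLodd hL2 hc35 p ha haa hb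

end Face

end Summit.QuantumFields.YangMills.BalabanUVNodes.N15.VectorPiece
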